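import Mathlib
import HarnessLib

/-!
# Arc confinement: the leading term of an arc in a fibre-smooth germ lies in the linear image
# (WEIL-2 gen 28, TRIPLE-G28 §4, fact-free formal core)

research route, not a corollary; conditional on HC_CM plus one named minimal statement.

Cell `pub-hodge-ring2-ab-*` (ALL ABELIAN VARIETIES), seat WEIL-2 gen 28, account
`run/shared/lean/pub/pub-hodge-ring2/pub-hodge-ring2-ab-weil-2/TRIPLE-G28.md` §4 (CONFINEMENT THEOREM).

Informal setting (not formalised).  Let `𝒴 → S` be a smooth family over a smooth base with coordinates
`s₁, …, s_d` at a point `0`, `Z ⊂ Y₀` a closed subscheme, and `H` the germ of the relative Hilbert scheme at `[Z]`.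
If the fibre `Hilb(Y₀)` is smooth at `[Z]` («`Z` is unobstructed inside `Y₀`»), then `H` embeds in `S × 𝔸^N`
(`N = h⁰(N_Z)`) with the whole fibre `{0} × 𝔸^N` inside `H`, so every equation of `H` has the form
`f = Σ_i s_i · g_i(s, x)`; the first-order liftable directions are `L(Z) = {κ : Σ_i κ_i g_i(0,0) = 0 for all f}`.
An arc `u ↦ (s(u), x(u))` inside `H` with `s(u) = κ u^m + O(u^{m+1})` (ANY ramification order `m ≥ 1`) then has
`0 = f(s(u), x(u)) = u^m · Σ_i κ_i g_i(0,0) + O(u^{m+1})`, so `κ ∈ L(Z)`: ramified arcs give an unobstructed-inside-`Y₀`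
subscheme NO new directions (TRIPLE-G28 §4; LIMITS-G25 1.4–1.5 stated this for clusters).  This file is the exact
coefficient identity behind the displayed equation, over any commutative semiring, for finitely many power series:

* `coeff_mul_eq_of_coeff_lt_eq_zero` — if `coeff k s = 0` for all `k < m`, then `coeff m (s * g) = coeff m s * constantCoeff g`;
* `sum_coeff_mul_constantCoeff_eq_zero` — if moreover `Σ_i s_i * g_i = 0`, then `Σ_i coeff m (s_i) * constantCoeff (g_i) = 0`
  (the leading coefficient vector `κ = (coeff m s_i)_i` satisfies the linearised equation).

0 sorry, no `def`, no named fact; `HC_CM` does not occur.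
-/

namespace Summit.HodgeConjecture.Ring2AbelianAll.NonsplitArcConfinement

open PowerSeries Finset

variable {R : Type*} [CommSemiring R]

/-- **Leading coefficient of a product.**  If the power series `s` has no terms below degree `m`, then the
degree-`m` coefficient of `s * g` is the degree-`m` coefficient of `s` times the constant coefficient of `g`.
research route, not a corollary; conditional on HC_CM plus one named minimal statement. [locator TRIPLE-G28 §4 CONFINEMENT THEOREM] -/
theorem coeff_mul_eq_of_coeff_lt_eq_zero (s g : R⟦X⟧) (m : ℕ) (hs : ∀ k < m, coeff k s = 0) :
    coeff m (s * g) = coeff m s * constantCoeff g := by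
  rw [coeff_mul, Finset.sum_eq_single (m, 0)]
  · rw [coeff_zero_eq_constantCoeff_apply]
  · rintro ⟨a, b⟩ hab hne
    have hsum : a + b = m := by simpa using hab
    have ha : a < m := by
      rcases Nat.lt_or_ge a m with h | h
      · exact h
      · exfalso
        have hb : b = 0 := by omega
        have ha' : a = m := by omega
        exact hne (by rw [ha', hb])
    rw [hs a ha, zero_mul]
  · intro h
    exact absurd (by simp) h

/-- **Arc confinement (formal core).**  Let `s₁, …, s_n` be power series with no terms below degree `m` (an arc of
ramification order `m` in the base coordinates) and `g₁, …, g_n` arbitrary power series (the coefficient functions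
of an equation `Σ_i s_i g_i` of the fibre-smooth germ, evaluated along the arc).  If `Σ_i s_i * g_i = 0`, then the
leading coefficient vector satisfies the LINEARISED equation `Σ_i (coeff m s_i) * g_i(0) = 0` — the arc's leading
direction lies in the first-order liftable space, whatever the ramification order `m`.
research route, not a corollary; conditional on HC_CM plus one named minimal statement. [locator TRIPLE-G28 §4 CONFINEMENT THEOREM] -/
theorem sum_coeff_mul_constantCoeff_eq_zero {ι : Type*} (t : Finset ι) (s g : ι → R⟦X⟧) (m : ℕ)
    (hs : ∀ i ∈ t, ∀ k < m, coeff k (s i) = 0) (hz : ∑ i ∈ t, s i * g i = 0) :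
    ∑ i ∈ t, coeff m (s i) * constantCoeff (g i) = 0 := by
  have h := congrArg (coeff m) hz
  rw [map_sum, map_zero] at h
  rw [← h]
  refine Finset.sum_congr rfl ?_
  intro i hi
  rw [coeff_mul_eq_of_coeff_lt_eq_zero (s i) (g i) m (hs i hi)]

/-- **Arc confinement, single equation with an explicit leading vector.**  If `s_i = κ_i • X^m + (terms of degree
> m)` in the sense that `coeff k (s_i) = 0` for `k < m` and `coeff m (s_i) = κ_i`, and `Σ_i s_i * g_i = 0`, then
`Σ_i κ_i * g_i(0) = 0`.
research route, not a corollary; conditional on HC_CM plus one named minimal statement. [locator TRIPLE-G28 §4 CONFINEMENT THEOREM] -/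
theorem leading_vector_mem_linearised {ι : Type*} (t : Finset ι) (s g : ι → R⟦X⟧) (m : ℕ) (κ : ι → R)
    (hs : ∀ i ∈ t, ∀ k < m, coeff k (s i) = 0) (hκ : ∀ i ∈ t, coeff m (s i) = κ i)
    (hz : ∑ i ∈ t, s i * g i = 0) :
    ∑ i ∈ t, κ i * constantCoeff (g i) = 0 := by
  rw [← sum_coeff_mul_constantCoeff_eq_zero t s g m hs hz]
  refine Finset.sum_congr rfl ?_
  intro i hi
  rw [hκ i hi]

end Summit.HodgeConjecture.Ring2AbelianAll.NonsplitArcConfinement
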